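import Mathlib
import Literature.NumberTheory.LFunctions.Zhang2022.Section17SummedError
import Literature.NumberTheory.LFunctions.Zhang2022.SkeletonAlpha1
import Literature.NumberTheory.LFunctions.Zhang2022.SkeletonWindowPowers
import HarnessLib

/-!
# Zhang (2022) §17.u024: the summed-error estimate `hE` at the rate `α₁ = α log T`

Topic `Literature/NumberTheory/LFunctions/Zhang2022` (Landau–Siegel audit tree; verdict-neutral; ZHANG-L discharge
lane, helper under the v19 leaf `Typed.Section17.Eq17_9Rel` / its E-port `Eq17_9RelE`). Y. Zhang, *Discrete mean
estimates and the Landau–Siegel zero*, arXiv:2211.02515v1 (2022) [Zhang2022LandauSiegel] — **an unrefereed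
manuscript under adjudication**; nothing here asserts its Theorems 1–2.

`Zhang2022/Section17SummedError.lean` (zl-w16-p3) proves the one unprinted input `hE` of the step u021 + u023 ⇒
u024 (cell GAP row G-d58-1) at the banked rate `α𝓛`: `α𝓛·Σ_{1≤l<D⁴}(|ν(l)|/l)Σ_{l=l₁l₂}τ₂(l₁)|ν₁*(l₂)| ≤ ε`
(indeed `≤ K𝓛⁻⁴`). The E-port of the §17 chain consumes Lemma 15.1 at its PRINTED rate `α₁ = α log T =
α𝓛^{1.1}` (`Skeleton.alpha1`, `Skeleton.Lemma151ChiRE`; referee word zl-w16-ref-1, 2026-08-27), so the same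
estimate is wanted with `α₁` in place of `α𝓛`; since `α₁ = α𝓛·𝓛^{0.1}` the margin `𝓛⁻⁴` becomes `𝓛^{−3.9}`:

* `step17_hE_alpha1_holds : ∀ c′ ε, 0 < ε → ForAllLarge ((A) → α₁·Σ_{1≤l<D⁴}(|ν(l)|/l)Σ τ₂(l₁)|ν₁*(l₂)| ≤ ε)`.

The proof is the proof of `Phi3Eval.step17_hE_holds` verbatim up to the last line (same majorants `F₁, F₂`,
same Euler-product counts `sum_F1_div_le`/`sum_F2_div_le`, same thresholds `hE_thresholds`), closed with
`α₁ = (α𝓛)·𝓛^{0.1} ≤ (α𝓛)·𝓛` and `K/𝓛³ ≤ ε`.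

## References

* Y. Zhang, arXiv:2211.02515v1 (2022), §17 p. 98 (u024), §15 Lemma 15.1 (rate `α₁`), §6 p. 28 (`T`).
  [cite: Zhang2022LandauSiegel, §17 u024 p.98]
-/

noncomputable section

open Complex Real Finset ArithmeticFunction
open Literature.NumberTheory.LFunctions.Zhang2022.Skeleton
open Literature.NumberTheory.LFunctions.Zhang2022.Typed.Section17
open Literature.NumberTheory.LFunctions.Zhang2022.MeanSquareMajorant

namespace Literature.NumberTheory.LFunctions.Zhang2022.Phi3Eval

/-- A member `(a, b)` of the divisor antidiagonal of `n` has `b ≤ n`. [folklore] -/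
private theorem snd_le_of_mem_divisorsAntidiagonal {n : ℕ} {x : ℕ × ℕ}
    (hx : x ∈ n.divisorsAntidiagonal) : x.2 ≤ n := by
  have h := Nat.mem_divisorsAntidiagonal.1 hx
  exact Nat.le_of_dvd (Nat.pos_of_ne_zero h.2) ⟨x.1, by rw [mul_comm]; exact h.1.symm⟩

/-- `α₁ ≤ (α𝓛)·𝓛` for `𝓛 ≥ 1` (`α₁ = α𝓛^{1.1}`, `𝓛^{1.1} ≤ 𝓛²`). [cite: Zhang2022LandauSiegel, §6 p.28] -/
theorem alpha1_le_alpha_mul_ell_sq {D : ℕ} (hℓ : 1 ≤ ell D) : alpha1 D ≤ alpha D * ell D * ell D := by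
  rw [alpha1, log_bigT, mul_assoc]
  have hα : 0 ≤ alpha D := (alpha_pos' (by linarith)).le
  refine mul_le_mul_of_nonneg_left ?_ hα
  calc ell D ^ (1.1 : ℝ) ≤ ell D ^ (2 : ℝ) := Real.rpow_le_rpow_of_exponent_le hℓ (by norm_num)
    _ = ell D * ell D := by rw [show (2 : ℝ) = (2 : ℕ) by norm_num, Real.rpow_natCast, sq]

/-- **The summed-error estimate of §17.u024 at the printed Lemma-15.1 rate `α₁ = α log T`, PROVED.** For every
`c′` and every `ε > 0`, for all large `D` (no use of (A)):
`α₁ · Σ_{1≤l<D⁴} (|ν(l)|/l) Σ_{l=l₁l₂} τ₂(l₁)|ν₁*(l₂)| ≤ ε` — indeed `≤ K𝓛^{−3.9} ≤ K𝓛⁻³`, by the proof of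
`Phi3Eval.step17_hE_holds` (`|ν₁*(l₂)| ≤ |(μχ∗1)(l₂)| + 63α𝓛·τ₄(l₂)`, the Euler-product counts
`Σ F₁/l ≤ M₁(4𝓛)⁴`, `Σ F₂/l ≤ M₂(4𝓛)¹²`, `α𝓛 = π𝓛⁻⁸`) and `α₁ ≤ α𝓛·𝓛`.
[cite: Zhang2022LandauSiegel, §17 u024 p.98] -/
theorem step17_hE_alpha1_holds (c' : ℝ) : ∀ ε : ℝ, 0 < ε → ForAllLarge fun D _ χ => AssumptionA D χ →
      alpha1 D * ∑ l ∈ Finset.Ico 1 (D ^ 4), ‖nu χ l‖ / l *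
        ∑ q ∈ l.divisorsAntidiagonal, (q.1.divisors.card : ℝ) * ‖nuOneStar c' χ q.2‖ ≤ ε := by
  intro ε hε
  set K : ℝ := Real.pi * (majorantConst 4 6 * 4 ^ 4 + 63 * Real.pi * majorantConst 12 8 * 4 ^ 12)
    with hK
  have hK0 : 0 ≤ K := by
    have h1 := (majorantConst_pos 4 6).le
    have h2 := (majorantConst_pos 12 8).le
    have hπ := Real.pi_pos.le
    positivity
  obtain ⟨D₀, hD₀⟩ := hE_thresholds c' K ε hε
  obtain ⟨D₁, hD₁⟩ := exists_nat_forall_le_ell (K / ε)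
  refine ⟨max D₀ D₁, fun D _ χ hD hq _ _ => ?_⟩
  obtain ⟨hℓ3, hc, hT, hsmall, -⟩ := hD₀ D (le_trans (le_max_left _ _) hD)
  have hKε : K / ε ≤ ell D := hD₁ D (le_trans (le_max_right _ _) hD)
  have hℓ1 : 1 ≤ ell D := by linarith
  have hℓ0 : 0 < ell D := by linarith
  have hπ := Real.pi_pos
  have hα0 : 0 < alpha D := alpha_pos' hℓ0
  have hα : alpha D = Real.pi / ell D ^ 9 := by rw [alpha, bigP, Real.log_exp]
  have hαℓ : alpha D * ell D = Real.pi / ell D ^ 8 := by rw [hα]; field_simp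
  have hαℓ0 : 0 ≤ alpha D * ell D := by positivity
  -- `δ = 21α𝓛 ≤ 1`
  set δ : ℝ := 21 * (alpha D * ell D) with hδ
  have hδ0 : 0 ≤ δ := by positivity
  have hδ1 : δ ≤ 1 := by
    rw [hδ, hαℓ, ← mul_div_assoc, div_le_one (by positivity)]
    have h8 : (3 : ℝ) ^ 8 ≤ ell D ^ 8 := pow_le_pow_left₀ (by norm_num) hℓ3 8
    nlinarith [Real.pi_lt_four]
  -- `|β₂|, |β₃| ≤ 5α`, purely imaginary
  have hβ2 : ‖beta2 c' D‖ ≤ 5 * alpha D :=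
    (ResidueValues.norm_beta2_le c' hℓ3 hc).trans (by linarith)
  have hβ3 : ‖beta3 c' D‖ ≤ 5 * alpha D :=
    (ResidueValues.norm_beta3_le c' hℓ3 hc).trans (by linarith)
  have hβ2re : (beta2 c' D).re = 0 := by simp [beta2]
  have hβ3re : (beta3 c' D).re = 0 := by simp [beta3]
  have hη : ∀ n : ℕ, n ≠ 0 → n ≤ D ^ 4 →
      ‖nN D (beta2 c' D) n - 1‖ ≤ δ ∧ ‖nN D (beta3 c' D) n - 1‖ ≤ δ := fun n hn hnD =>
    ⟨norm_nN_sub_one_le hℓ1 hT hsmall hβ2re hβ2 hn hnD,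
      norm_nN_sub_one_le hℓ1 hT hsmall hβ3re hβ3 hn hnD⟩
  -- `D ≥ 2`, `log D⁴ = 4𝓛`
  have hD2 : 2 ≤ D := by
    by_contra h
    have hD1 : (D : ℝ) ≤ 1 := by exact_mod_cast (by omega : D ≤ 1)
    have : ell D ≤ 0 := Real.log_nonpos (Nat.cast_nonneg D) hD1
    linarith
  have hX2 : 2 ≤ D ^ 4 := le_trans hD2 (Nat.le_self_pow (by norm_num) D)
  have hlogX : Real.log ((D ^ 4 : ℕ) : ℝ) = 4 * ell D := by
    push_cast; rw [Real.log_pow]; push_cast; rfl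
  -- abbreviations for the two majorants
  set F₁ : ℕ → ℝ := fun l => ((normAF ((ArithmeticFunction.zeta : ArithmeticFunction ℂ) *
        toArithmeticFunction (fun n : ℕ => χ (n : ZMod D)))).pmul
      (tau 2 * normAF (((ArithmeticFunction.moebius : ArithmeticFunction ℂ).pmul
        (toArithmeticFunction (fun n : ℕ => χ (n : ZMod D)))) *
          (ArithmeticFunction.zeta : ArithmeticFunction ℂ)))) l with hF₁
  set F₂ : ℕ → ℝ := fun l => ((normAF ((ArithmeticFunction.zeta : ArithmeticFunction ℂ) *
        toArithmeticFunction (fun n : ℕ => χ (n : ZMod D)))).pmul (tau 6)) l with hF₂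
  have hF₁0 : ∀ l, 0 ≤ F₁ l := fun l =>
    (isBlock_pmul (isBlock_normAF_nu χ) ((isBlock_tau 2).mul (isBlock_normAF_moebiusChi_mul_zeta χ))).nonneg l
  have hF₂0 : ∀ l, 0 ≤ F₂ l := fun l => (isBlock_pmul (isBlock_normAF_nu χ) (isBlock_tau 6)).nonneg l
  -- Step 1: termwise
  have hterm : ∀ l ∈ Finset.Ico 1 (D ^ 4), ‖nu χ l‖ / l *
      ∑ q ∈ l.divisorsAntidiagonal, (q.1.divisors.card : ℝ) * ‖nuOneStar c' χ q.2‖ ≤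
        (F₁ l + 3 * δ * F₂ l) / l := by
    intro l hl
    have hl4 : l ≤ D ^ 4 := (Finset.mem_Ico.1 hl).2.le
    have hinner : ∑ q ∈ l.divisorsAntidiagonal, (q.1.divisors.card : ℝ) * ‖nuOneStar c' χ q.2‖ ≤
        ∑ q ∈ l.divisorsAntidiagonal, tau 2 q.1 *
          (‖∑ d ∈ q.2.divisors, (ArithmeticFunction.moebius d : ℂ) * χ (d : ZMod D)‖ +
            3 * δ * tau 4 q.2) := Finset.sum_le_sum fun q hq => by
      have hq2le := snd_le_of_mem_divisorsAntidiagonal hq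
      rw [← tau_two_apply]
      exact mul_le_mul_of_nonneg_left (norm_nuOneStar_le c' χ hδ0 hδ1 (hq2le.trans hl4) hη)
        (tau_nonneg _ _)
    have heq : ‖nu χ l‖ * ∑ q ∈ l.divisorsAntidiagonal, tau 2 q.1 *
        (‖∑ d ∈ q.2.divisors, (ArithmeticFunction.moebius d : ℂ) * χ (d : ZMod D)‖ +
          3 * δ * tau 4 q.2) = F₁ l + 3 * δ * F₂ l := by
      simp only [hF₁, hF₂, F1_apply, F2_apply, Finset.mul_sum, ← Finset.sum_add_distrib]
      exact Finset.sum_congr rfl fun q _ => by ring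
    have hl0 : (0 : ℝ) ≤ l := Nat.cast_nonneg l
    calc ‖nu χ l‖ / l * ∑ q ∈ l.divisorsAntidiagonal, (q.1.divisors.card : ℝ) * ‖nuOneStar c' χ q.2‖
        = (‖nu χ l‖ * ∑ q ∈ l.divisorsAntidiagonal,
            (q.1.divisors.card : ℝ) * ‖nuOneStar c' χ q.2‖) / l := div_mul_eq_mul_div _ _ _
      _ ≤ (‖nu χ l‖ * ∑ q ∈ l.divisorsAntidiagonal, tau 2 q.1 *
            (‖∑ d ∈ q.2.divisors, (ArithmeticFunction.moebius d : ℂ) * χ (d : ZMod D)‖ +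
              3 * δ * tau 4 q.2)) / l :=
          div_le_div_of_nonneg_right (mul_le_mul_of_nonneg_left hinner (norm_nonneg _)) hl0
      _ = (F₁ l + 3 * δ * F₂ l) / l := by rw [heq]
  -- Step 2: the two Euler-product counts at `X = D⁴`, `log X = 4𝓛`
  have h1 := sum_F1_div_le χ hq hX2
  have h2 := sum_F2_div_le χ hq hX2
  rw [hlogX] at h1 h2
  have h3δ : 0 ≤ 3 * δ := by positivity
  have hsum : ∑ l ∈ Finset.Ico 1 (D ^ 4), (F₁ l + 3 * δ * F₂ l) / l ≤
      majorantConst 4 6 * (4 * ell D) ^ 4 + 3 * δ * (majorantConst 12 8 * (4 * ell D) ^ 12) := by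
    calc ∑ l ∈ Finset.Ico 1 (D ^ 4), (F₁ l + 3 * δ * F₂ l) / l
        ≤ ∑ l ∈ Finset.Icc 1 (D ^ 4), (F₁ l + 3 * δ * F₂ l) / l :=
          Finset.sum_le_sum_of_subset_of_nonneg Finset.Ico_subset_Icc_self fun l _ _ =>
            div_nonneg (add_nonneg (hF₁0 l) (mul_nonneg h3δ (hF₂0 l))) (Nat.cast_nonneg l)
      _ = (∑ l ∈ Finset.Icc 1 (D ^ 4), F₁ l / l) +
            3 * δ * ∑ l ∈ Finset.Icc 1 (D ^ 4), F₂ l / l := by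
          rw [Finset.mul_sum, ← Finset.sum_add_distrib]
          exact Finset.sum_congr rfl fun l _ => by ring
      _ ≤ majorantConst 4 6 * (4 * ell D) ^ 4 + 3 * δ * (majorantConst 12 8 * (4 * ell D) ^ 12) :=
          add_le_add h1 (mul_le_mul_of_nonneg_left h2 h3δ)
  -- Step 3: the numbers (`α𝓛 = π𝓛⁻⁸`, `δ = 21α𝓛`, `α₁ ≤ α𝓛·𝓛`)
  have hE : (∑ l ∈ Finset.Ico 1 (D ^ 4), ‖nu χ l‖ / l *
        ∑ q ∈ l.divisorsAntidiagonal, (q.1.divisors.card : ℝ) * ‖nuOneStar c' χ q.2‖) ≤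
      majorantConst 4 6 * (4 * ell D) ^ 4 + 3 * δ * (majorantConst 12 8 * (4 * ell D) ^ 12) :=
    (Finset.sum_le_sum hterm).trans hsum
  have hE0 : 0 ≤ ∑ l ∈ Finset.Ico 1 (D ^ 4), ‖nu χ l‖ / l *
      ∑ q ∈ l.divisorsAntidiagonal, (q.1.divisors.card : ℝ) * ‖nuOneStar c' χ q.2‖ :=
    Finset.sum_nonneg fun l _ => mul_nonneg (div_nonneg (norm_nonneg _) (Nat.cast_nonneg _))
      (Finset.sum_nonneg fun q _ => by positivity)
  have hmain : alpha D * ell D * (majorantConst 4 6 * (4 * ell D) ^ 4 +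
      3 * δ * (majorantConst 12 8 * (4 * ell D) ^ 12)) = K / ell D ^ 4 := by
    rw [hK, hδ, hαℓ]
    field_simp
    ring
  have hKℓ : K / ell D ^ 4 * ell D ≤ ε := by
    have h1 : K / ell D ^ 4 * ell D = K / ell D ^ 3 := by field_simp
    rw [h1, div_le_iff₀ (by positivity)]
    have h2 : K ≤ ε * ell D := by rwa [div_le_iff₀ hε, mul_comm] at hKε
    have h3 : ell D ≤ ell D ^ 3 := le_self_pow₀ hℓ1 (by norm_num)
    nlinarith
  calc alpha1 D * (∑ l ∈ Finset.Ico 1 (D ^ 4), ‖nu χ l‖ / l *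
        ∑ q ∈ l.divisorsAntidiagonal, (q.1.divisors.card : ℝ) * ‖nuOneStar c' χ q.2‖)
      ≤ (alpha D * ell D * ell D) * (majorantConst 4 6 * (4 * ell D) ^ 4 +
          3 * δ * (majorantConst 12 8 * (4 * ell D) ^ 12)) :=
        mul_le_mul (alpha1_le_alpha_mul_ell_sq hℓ1) hE hE0 (by positivity)
    _ = K / ell D ^ 4 * ell D := by
        rw [show alpha D * ell D * ell D * (majorantConst 4 6 * (4 * ell D) ^ 4 +
            3 * δ * (majorantConst 12 8 * (4 * ell D) ^ 12)) =
          (alpha D * ell D * (majorantConst 4 6 * (4 * ell D) ^ 4 +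
            3 * δ * (majorantConst 12 8 * (4 * ell D) ^ 12))) * ell D by ring, hmain]
    _ ≤ ε := hKℓ

end Literature.NumberTheory.LFunctions.Zhang2022.Phi3Eval
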